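import Literature.AlgebraicGeometry.Resolution.ZariskiClosedPoints
import Literature.AlgebraicGeometry.Resolution.NagataCriterion
import Mathlib.RingTheory.Jacobson.Ring
import HarnessLib

/-!
# Local uniformization is needed only at closed points of the Zariski–Riemann space

Topic: `Literature/AlgebraicGeometry/Resolution`. Load-bearing analysis recorded by the standing
disprover of crux `PatchingRel` (stmt-ResolutionOfSingularities-0642, `LUrel_p → ResolutionInChar p`;
`Cruxes/PatchingRel/Disproof.lean` §2 (H8)), folklore (Zariski 1944 §1; Zariski–Samuel II,
Ch. VI §17; Cossart–Piltant 2019, §4.1 and proof of Prop. 4.6, Step 3: "The assumption on `v`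
in (LU) means that `v` is a closed point of `Zar(𝒳)`"):

RELATIVE local uniformization of a function field `K/k` — every finitely generated
`k`-subalgebra `R ⊆ O` of a valuation ring `O` of `K/k` is dominated by a finitely generated
`A`, `R ≤ A ⊆ O`, with `Frac A = K` and `A` regular at the centre of `O` — holds at EVERY
valuation ring as soon as it holds at the ZERO-DIMENSIONAL ones (residue field algebraic over
`k`; the closed points of `Zar(K/k)`):

* `isRegularLocalRing_centre_of_le` — regularity at the centre passes from a refinement
  `O' ≤ O` to `O` (the centre of `O` on `A` is a sub-prime of the centre of `O'`; Serre's
  theorem, tree `mem_regularLocus_of_le`).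
* `exists_minimal_valuationSubring_le` — below every valuation ring `O ⊇ R` lies one which is
  minimal among those containing `R` (a closed point of `Zar(K/R)` in the closure of `O`; tree
  `ZariskiRiemannSpace.exists_le_isClosed`).
* `exists_aeval_mem_nonunits_of_minimal` — such a minimal `O'`, for `R` finitely generated over
  the field `k`, is zero-dimensional over `k`: its residue field is integral over the image of
  `R` (tree `isClosed_singleton_iff_isIntegral`), which is then a field finitely generated over
  `k`, hence finite over `k` (Zariski's lemma, Mathlib `finite_of_finite_type_of_isJacobsonRing`).
* `relLU_of_relLU_zeroDim` — the reduction itself, for a fixed `K/k`.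

Consequence for the crux (Disproof.lean (H8)): the antecedent `LUrel_p` is equivalent to its
restriction to zero-dimensional valuation rings; combined with (H7) (`lurel_of_essFiniteType`:
free at valuation rings essentially of finite type) its content sits at zero-dimensional
valuations that are not essentially of finite type over `k`.

## Sources

* O. Zariski, P. Samuel, *Commutative Algebra* II, Ch. VI §17 (Thms. 38–40). [ZariskiSamuel1960]
* V. Cossart, O. Piltant, J. Algebra 529 (2019), §4.1 (LU), proof of Prop. 4.6 Step 3.
  [CossartPiltant2019] The lemmas themselves are folklore.
-/

open IsLocalRing Polynomial

namespace Literature.AlgebraicGeometry.Resolution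

universe u v

variable {k : Type u} {K : Type v} [Field k] [Field K] [Algebra k K]

/-- **Regularity at the centre descends to coarsenings.** If `O' ≤ O` are valuation rings of
`K` containing the `k`-subalgebra `A` and `A` localised at the centre of `O'` is a regular local
ring, then so is `A` localised at the centre of `O`: the latter centre is contained in the
former (`𝔪_O ⊆ 𝔪_{O'}`), so the second localisation is a localisation of the first at a prime,
regular by Serre's theorem (tree `mem_regularLocus_of_le`). [folklore] -/
theorem isRegularLocalRing_centre_of_le (A : Subalgebra k K) {O O' : ValuationSubring K}
    (hle : O' ≤ O) (h' : A.toSubring ≤ O'.toSubring) (h : A.toSubring ≤ O.toSubring)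
    (hreg : IsRegularLocalRing (Localization.AtPrime
      (Ideal.comap (Subring.inclusion h') (maximalIdeal O')))) :
    IsRegularLocalRing (Localization.AtPrime
      (Ideal.comap (Subring.inclusion h) (maximalIdeal O))) := by
  set P : Ideal A.toSubring := Ideal.comap (Subring.inclusion h') (maximalIdeal O') with hP
  set Q : Ideal A.toSubring := Ideal.comap (Subring.inclusion h) (maximalIdeal O) with hQ
  have hQP : Q ≤ P := by
    intro a ha
    have ha' : Subring.inclusion h a ∈ maximalIdeal O := ha
    have h1 : (a : K) ∈ O.nonunits := ValuationSubring.coe_mem_nonunits_iff.mpr ha'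
    have h2 : (a : K) ∈ O'.nonunits := (ValuationSubring.nonunits_le_nonunits.mpr hle) h1
    change Subring.inclusion h' a ∈ maximalIdeal O'
    exact ValuationSubring.coe_mem_nonunits_iff.mp h2
  exact mem_regularLocus_of_le (A := A.toSubring) (P := ⟨P, inferInstance⟩)
    (Q := ⟨Q, inferInstance⟩) hQP hreg

/-- **A closed point of `Zar(K/R)` below a given valuation ring.** Below every valuation ring
`O ⊇ R` there is a valuation ring `O' ≤ O` containing `R` and minimal with this property
(`ZariskiRiemannSpace.exists_le_isClosed`, `isClosed_singleton_iff_forall_le`). [folklore] -/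
theorem exists_minimal_valuationSubring_le (R : Subalgebra k K) (O : ValuationSubring K)
    (hRO : R.toSubring ≤ O.toSubring) :
    ∃ O' : ValuationSubring K, O' ≤ O ∧ R.toSubring ≤ O'.toSubring ∧
      ∀ O'' : ValuationSubring K, O'' ≤ O' → R.toSubring ≤ O''.toSubring → O'' = O' := by
  let w : ZariskiRiemannSpace R K := ⟨O, fun r => hRO r.2⟩
  obtain ⟨v, hvO, hvc⟩ := ZariskiRiemannSpace.exists_le_isClosed w
  have hRv : R.toSubring ≤ v.asValuationSubring.toSubring := fun x hx => v.algebraMap_mem ⟨x, hx⟩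
  refine ⟨v.asValuationSubring, hvO, hRv, fun O'' hO'' hRO'' => ?_⟩
  have := ZariskiRiemannSpace.isClosed_singleton_iff_forall_le.mp hvc ⟨O'', fun r => hRO'' r.2⟩ hO''
  exact congrArg ZariskiRiemannSpace.asValuationSubring this

/-- **Closed points of `Zar(K/R)` are zero-dimensional over `k`.** If `R` is a finitely
generated `k`-subalgebra of `K` and the valuation ring `O ⊇ R` is minimal among the valuation
rings containing `R`, then every `x ∈ O` is a root modulo `𝔪_O` of a non-zero polynomial over
`k` (the residue field of `O` is algebraic over `k`): the residue field is integral over the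
image of `R` (`ZariskiRiemannSpace.isClosed_singleton_iff_isIntegral`), which is therefore a
field (`isField_of_isIntegral_of_isField`) finitely generated over `k`, hence finite over `k`
by Zariski's lemma (`finite_of_finite_type_of_isJacobsonRing`). [folklore] -/
theorem exists_aeval_mem_nonunits_of_minimal (R : Subalgebra k K) (hRfg : R.FG)
    (O : ValuationSubring K) (hRO : R.toSubring ≤ O.toSubring)
    (hmin : ∀ O'' : ValuationSubring K, O'' ≤ O → R.toSubring ≤ O''.toSubring → O'' = O) :
    ∀ x ∈ O, ∃ f : Polynomial k, f ≠ 0 ∧ Polynomial.aeval x f ∈ O.nonunits := by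
  classical
  let v : ZariskiRiemannSpace R K := ⟨O, fun r => hRO r.2⟩
  have hvc : IsClosed ({v} : Set (ZariskiRiemannSpace R K)) := by
    refine ZariskiRiemannSpace.isClosed_singleton_iff_forall_le.mpr fun w hw => ?_
    exact ZariskiRiemannSpace.asValuationSubring_injective
      (hmin w.asValuationSubring hw fun x hx => w.algebraMap_mem ⟨x, hx⟩)
  have hint : v.residueHom.IsIntegral :=
    ZariskiRiemannSpace.isClosed_singleton_iff_isIntegral.mp hvc
  -- `φ : R → κ(O)`; its kernel `m` is maximal since the image is a field
  set φ : R →+* ResidueField O := v.residueHom with hφ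
  haveI : Algebra.IsIntegral φ.range (ResidueField O) := by
    refine ⟨fun y => ?_⟩
    obtain ⟨p, hpm, hp⟩ := hint y
    refine ⟨p.map φ.rangeRestrict, hpm.map _, ?_⟩
    rw [Polynomial.eval₂_map]
    exact hp
  have hfield : IsField φ.range :=
    isField_of_isIntegral_of_isField (R := φ.range) (S := ResidueField O)
      Subtype.coe_injective (Field.toIsField _)
  set m : Ideal R := RingHom.ker φ with hm
  have hfield' : IsField (R ⧸ m) :=
    MulEquiv.isField hfield (RingHom.quotientKerEquivRange φ).toMulEquiv
  haveI hmmax : m.IsMaximal := Ideal.Quotient.maximal_of_isField m hfield'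
  letI : Field (R ⧸ m) := Ideal.Quotient.field m
  -- `R ⧸ m` is a finitely generated `k`-algebra and a field: finite over `k` (Zariski's lemma)
  haveI : Algebra.FiniteType k R := (Subalgebra.fg_iff_finiteType R).mp hRfg
  haveI : Algebra.FiniteType k (R ⧸ m) :=
    Algebra.FiniteType.of_surjective (Ideal.Quotient.mkₐ k m) (Ideal.Quotient.mkₐ_surjective k m)
  haveI : Module.Finite k (R ⧸ m) := finite_of_finite_type_of_isJacobsonRing k (R ⧸ m)
  have hkint : (algebraMap k (R ⧸ m)).IsIntegral := algebraMap_isIntegral_iff.mpr inferInstance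
  -- `φ̄ : R ⧸ m → κ(O)` is integral, hence so is `k → κ(O)`
  set φbar : R ⧸ m →+* ResidueField O := RingHom.kerLift φ with hφbar
  have hφbar : φbar.IsIntegral := by
    intro y
    obtain ⟨p, hpm, hp⟩ := hint y
    refine ⟨p.map (Ideal.Quotient.mk m), hpm.map _, ?_⟩
    rw [Polynomial.eval₂_map]
    have : φbar.comp (Ideal.Quotient.mk m) = φ := by
      ext r
      exact RingHom.kerLift_mk φ r
    rw [this]
    exact hp
  have hψ : (φbar.comp (algebraMap k (R ⧸ m))).IsIntegral := hkint.trans _ _ hφbar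
  -- translate to the element `x`
  intro x hx
  have hkO : ∀ c : k, algebraMap k K c ∈ O := fun c => hRO (R.algebraMap_mem c)
  let ι : k →+* O := (algebraMap k K).codRestrict O hkO
  have hψ' : φbar.comp (algebraMap k (R ⧸ m)) = (residue O).comp ι := by
    ext c
    rfl
  obtain ⟨q, hqm, hq⟩ := hψ (residue O ⟨x, hx⟩)
  refine ⟨q, hqm.ne_zero, ?_⟩
  rw [hψ'] at hq
  have h1 : residue O (q.eval₂ ι ⟨x, hx⟩) = q.eval₂ ((residue O).comp ι) (residue O ⟨x, hx⟩) :=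
    Polynomial.hom_eval₂ q ι (residue O) ⟨x, hx⟩
  have h2 : ((q.eval₂ ι ⟨x, hx⟩ : O) : K) = Polynomial.aeval x q := by
    rw [Polynomial.aeval_def,
      show ((q.eval₂ ι ⟨x, hx⟩ : O) : K) = O.subtype (q.eval₂ ι ⟨x, hx⟩) from rfl,
      Polynomial.hom_eval₂]
    rfl
  rw [← h2]
  refine ValuationSubring.coe_mem_nonunits_iff.mpr ?_
  rw [← residue_eq_zero_iff, h1]
  exact hq

/-- **Relative local uniformization at zero-dimensional valuations implies it everywhere**
(fixed `K/k`). If for every valuation ring `O ⊇ k` of `K` whose residue field is algebraic over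
`k` (every `x ∈ O` is a root modulo `𝔪_O` of a non-zero polynomial over `k`) and every finitely
generated `R ⊆ O` there is a finitely generated `A ⊆ O` with `R ≤ A`, `Frac A = K` and `A`
regular at the centre of `O`, then the same holds at EVERY valuation ring `O ⊇ k` of `K`:
refine `O` to a valuation ring minimal over `R` (zero-dimensional), uniformize there, and use
that regularity at the centre descends to the coarsening `O`. [cite: ZariskiSamuel1960, Ch. VI §17] -/
theorem relLU_of_relLU_zeroDim
    (h : ∀ O : ValuationSubring K, (∀ c : k, algebraMap k K c ∈ O) →
      (∀ x ∈ O, ∃ f : Polynomial k, f ≠ 0 ∧ Polynomial.aeval x f ∈ O.nonunits) →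
      ∀ R : Subalgebra k K, R.FG → R.toSubring ≤ O.toSubring →
      ∃ (A : Subalgebra k K) (h : A.toSubring ≤ O.toSubring),
        R ≤ A ∧ A.FG ∧ IsFractionRing A K ∧ IsRegularLocalRing (Localization.AtPrime
          (Ideal.comap (Subring.inclusion h) (IsLocalRing.maximalIdeal O))))
    (O : ValuationSubring K) (R : Subalgebra k K) (hRfg : R.FG)
    (hRO : R.toSubring ≤ O.toSubring) :
    ∃ (A : Subalgebra k K) (h : A.toSubring ≤ O.toSubring),
      R ≤ A ∧ A.FG ∧ IsFractionRing A K ∧ IsRegularLocalRing (Localization.AtPrime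
        (Ideal.comap (Subring.inclusion h) (IsLocalRing.maximalIdeal O))) := by
  obtain ⟨O', hO'O, hRO', hmin⟩ := exists_minimal_valuationSubring_le R O hRO
  obtain ⟨A, hA, hRA, hAfg, hfr, hreg⟩ := h O' (fun c => hRO' (R.algebraMap_mem c))
    (exists_aeval_mem_nonunits_of_minimal R hRfg O' hRO' hmin) R hRfg hRO'
  exact ⟨A, fun x hx => hO'O (hA hx), hRA, hAfg, hfr,
    isRegularLocalRing_centre_of_le A hO'O hA _ hreg⟩

end Literature.AlgebraicGeometry.Resolution
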